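import Summits.Ventures.YMGap.RobustBall.TorusAxisCycle
import Summits.Ventures.YMGap.RobustBall.TorusAxisProfile
import Summits.Ventures.YMGap.RobustBall.TorusDoor
import HarnessLib

/-!
# Robust ball (Y2) — the column supersolution along one axis for the robust torus Dobrushin matrix of a tier-1 member

HONEST FRAMING: venture file of the cell `pub-ymgap` (QuantumFields programme), track ROBUST-BALL, seat rb-p2 (g10).  Strong-coupling LATTICE
bookkeeping on finite tori; the modulus `K` and the coupling enter only through the coefficient `A(x) = K e^{a(x)}(1 + 2√N ℓ_s(x))|β|/N` of ds-2's
robust torus door (`TorusDoor`); no measure theory here; nothing continuum / Clay.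
CONTENT.  `column_axis_le`: for a member with load witness `w` (`a ≤ ε₀`, `ℓ_s + Λ ≤ ε₁` per link), a link `x`, an axis `i`, a centre `c ∈ ℤ/2L` and the
cycle eigenvector `g` of `TorusAxisCycle`: `Σ_{z ∈ nbr x} C_W(x,z) g(H_i z − c) ≤ s · g(H_i x − c)` over the range-`r ⊔ 1` neighbourhood, as soon as
`K e^{ε₀}(1 + 2√N ε₁)(|β|/N)·max(P_∥(θ), P_⊥(θ)) + √N ε₁ θ⁻¹^{2(r⊔1)+1} ≤ s` (`P_∥ = 2(d−1)(θ+θ⁻¹+1)`, `P_⊥ = θ⁻²+2θ⁻¹+2θ+θ²+6(d−2)`; the Wilson part is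
`TorusAxisProfile.sum_tInfluence_mul_le_axis`, the cross loads enter once with weight `θ⁻¹^{2(r⊔1)+1}` because a neighbour's doubled coordinate differs by
`≤ 2(r⊔1)+1`); `row_axis_le`: the plain row is `≤ s` under the same condition.

## References
* H. Föllmer, LNM 1362 (1988), Ch. I; the tree: `TorusDoor` (ds-2), `TorusAxisProfile`, `TorusAxisCycle` (this seat).
-/

noncomputable section

open MeasureTheory Finset Function Real
open Literature.Probability.LatticeModels Literature.Probability.LatticeModels.DobrushinMetric
open Literature.MathematicalPhysics.QuantumLattice hiding torusNorm
open Literature.MathematicalPhysics.QuantumFieldTheory hiding ZdEdge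
open Literature.MathematicalPhysics.QuantumFieldTheory.Balaban1983to89.StrongCouplingTorusWindow

namespace Summit.Ventures.YMGap.RobustBall.TorusAxis

/-! ### The column supersolution along one axis for the member's Dobrushin matrix -/

section Column

variable {d L N : ℕ} [NeZero L]

/-- **One axis, one column.**  For a member with witness `w` (`a ≤ ε₀`, `ℓ_s + Λ ≤ ε₁` per link) of range `r`, a link `x`, an axis `i`, a centre `c ∈ ℤ/2L`
and the cycle eigenvector `g`: `Σ_{z ∈ nbr x} C_W(x,z) g(H_i z − c) ≤ s · g(H_i x − c)` as soon as
`K e^{ε₀}(1+2√Nε₁)(|β|/N) P(θ) + √N ε₁ θ⁻¹^{2(r⊔1)+1} ≤ s`. [folklore] -/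
theorem column_axis_le (hd : 2 ≤ d) (hL : 2 ≤ L) {β K ε₀ ε₁ θ s : ℝ} {r : ℕ} (hK : 0 ≤ K) (hθ0 : 0 < θ) (hθ1 : θ ≤ 1)
    {W : Perturbation d L N} (w : LoadWitness W) (hwa : ∀ e, w.oscLoad 0 e ≤ ε₀)
    (hwℓ : ∀ e, w.selfLipLoad 0 e + w.crossLipLoad 0 e ≤ ε₁)
    (hsup : K * Real.exp ε₀ * (1 + 2 * Real.sqrt N * ε₁) * (|β| / N) *
        max (2 * ((d : ℝ) - 1) * (θ + θ⁻¹ + 1)) (θ⁻¹ ^ 2 + 2 * θ⁻¹ + 2 * θ + θ ^ 2 + 6 * ((d : ℝ) - 2)) +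
      Real.sqrt N * ε₁ * θ⁻¹ ^ (2 * max r 1 + 1) ≤ s)
    {g : ZMod (2 * L) → ℝ} (hg0 : ∀ k, 0 < g k) (hg1 : ∀ k, g (k + 1) + g (k - 1) ≤ (θ + θ⁻¹) * g k)
    (hgu : ∀ k, g (k + 1) ≤ θ⁻¹ * g k) (hgd : ∀ k, g (k - 1) ≤ θ⁻¹ * g k) (x : Edge d L) (i : Fin d) (c : ZMod (2 * L)) :
    ∑ z ∈ (univ.erase x).filter (fun y => torusNorm (x.1 - y.1) ≤ max r 1),
        (K * Real.exp (w.oscLoad 0 x) * (1 + 2 * Real.sqrt N * w.selfLipLoad 0 x) * (|β| / N) * tInfluence x z +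
          Real.sqrt N * w.crossLip 0 x z) *
          g ((((2 * (z.1 i).val : ℕ) : ZMod (2 * L)) + (if z.2 = i then 1 else 0)) - c) ≤
      s * g ((((2 * (x.1 i).val : ℕ) : ZMod (2 * L)) + (if x.2 = i then 1 else 0)) - c) := by
  set nbr := (univ.erase x).filter (fun y => torusNorm (x.1 - y.1) ≤ max r 1) with hnbr
  set G : ZMod (2 * L) → ℝ := fun k => g (k - c) with hG
  set A : ℝ := K * Real.exp (w.oscLoad 0 x) * (1 + 2 * Real.sqrt N * w.selfLipLoad 0 x) * (|β| / N) with hA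
  set P : ℝ := max (2 * ((d : ℝ) - 1) * (θ + θ⁻¹ + 1)) (θ⁻¹ ^ 2 + 2 * θ⁻¹ + 2 * θ + θ ^ 2 + 6 * ((d : ℝ) - 2)) with hP
  set T : ℝ := θ⁻¹ ^ (2 * max r 1 + 1) with hT
  have hGx : 0 < G (((2 * (x.1 i).val : ℕ) : ZMod (2 * L)) + (if x.2 = i then 1 else 0)) := hg0 _
  -- the shifted profile is again a supersolution
  have hG0 : ∀ k, 0 ≤ G k := fun k => (hg0 _).le
  have hG1 : ∀ k, G (k + 1) + G (k - 1) ≤ (θ + θ⁻¹) * G k := fun k => by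
    simp only [hG]; rw [show k + 1 - c = (k - c) + 1 by ring, show k - 1 - c = (k - c) - 1 by ring]; exact hg1 _
  have hG2 : ∀ k, G (k + 2) + G (k - 2) ≤ (θ ^ 2 + θ⁻¹ ^ 2) * G k := fun k => by
    have h1 := hG1 (k + 1)
    have h2 := hG1 (k - 1)
    rw [show k + 1 + 1 = k + 2 by ring, show k + 1 - 1 = k by ring] at h1
    rw [show k - 1 + 1 = k by ring, show k - 1 - 1 = k - 2 by ring] at h2
    have h3 := hG1 k
    have hθθ : 0 ≤ θ + θ⁻¹ := by positivity
    have e : (θ ^ 2 + θ⁻¹ ^ 2) * G k = (θ + θ⁻¹) * ((θ + θ⁻¹) * G k) - 2 * G k := by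
      have : θ * θ⁻¹ = 1 := mul_inv_cancel₀ hθ0.ne'
      ring_nf; rw [this]; ring
    rw [e]
    nlinarith [mul_le_mul_of_nonneg_left (add_le_add h1 h2) hθθ]
  have hGu : ∀ k, G (k + 1) ≤ θ⁻¹ * G k := fun k => by
    simp only [hG]; rw [show k + 1 - c = (k - c) + 1 by ring]; exact hgu _
  have hGd : ∀ k, G (k - 1) ≤ θ⁻¹ * G k := fun k => by
    simp only [hG]; rw [show k - 1 - c = (k - c) - 1 by ring]; exact hgd _
  -- Wilson part: the axis inequality of `TorusAxisProfile`
  have hW := sum_tInfluence_mul_le_axis hd hL (θ := θ) (G := G) hG0 hG1 hG2 x i nbr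
  have hPi : (if x.2 = i then 2 * ((d - 1 : ℕ) : ℝ) * (θ + θ⁻¹ + 1)
      else θ⁻¹ ^ 2 + 2 * θ⁻¹ + 2 * θ + θ ^ 2 + 6 * ((d - 2 : ℕ) : ℝ)) ≤ P := by
    have hd1 : ((d - 1 : ℕ) : ℝ) = (d : ℝ) - 1 := by rw [Nat.cast_sub (by omega)]; simp
    have hd2 : ((d - 2 : ℕ) : ℝ) = (d : ℝ) - 2 := by rw [Nat.cast_sub hd]; simp
    split_ifs
    · rw [hd1]; exact le_max_left _ _
    · rw [hd2]; exact le_max_right _ _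
  -- cross part: every neighbour is within torus distance `r ⊔ 1`
  have hcross : ∀ z ∈ nbr, G (((2 * (z.1 i).val : ℕ) : ZMod (2 * L)) + (if z.2 = i then 1 else 0)) ≤
      T * G (((2 * (x.1 i).val : ℕ) : ZMod (2 * L)) + (if x.2 = i then 1 else 0)) := by
    intro z hz
    have hzn : torusNorm (x.1 - z.1) ≤ max r 1 := (Finset.mem_filter.1 hz).2
    obtain ⟨u, hu, hzu⟩ := exists_hc_eq_add_of_torusNorm_le (i := i) hzn
    rw [hzu]
    refine (profile_add_int_le (M := 2 * L) hθ0 hGu hGd _ u).trans ?_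
    refine mul_le_mul_of_nonneg_right ?_ (hG0 _)
    exact pow_le_pow_right₀ ((one_le_inv₀ hθ0).2 hθ1) hu
  -- loads of the member at `x`
  have hA0 : 0 ≤ A := by
    simp only [hA]
    exact mul_nonneg (mul_nonneg (mul_nonneg hK (Real.exp_pos _).le)
      (add_nonneg zero_le_one (mul_nonneg (by positivity) (selfLipLoad_nonneg w 0 x)))) (by positivity)
  have hℓs : w.selfLipLoad 0 x ≤ ε₁ := by linarith [hwℓ x, crossLipLoad_nonneg w 0 x]
  have hΛ : w.crossLipLoad 0 x ≤ ε₁ := by linarith [hwℓ x, selfLipLoad_nonneg w 0 x]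
  have hε₁ : 0 ≤ ε₁ := (selfLipLoad_nonneg w 0 x).trans hℓs
  have hAle : A ≤ K * Real.exp ε₀ * (1 + 2 * Real.sqrt N * ε₁) * (|β| / N) := by
    simp only [hA]
    have h1 : Real.exp (w.oscLoad 0 x) ≤ Real.exp ε₀ := Real.exp_le_exp.2 (hwa x)
    have h2 : 1 + 2 * Real.sqrt N * w.selfLipLoad 0 x ≤ 1 + 2 * Real.sqrt N * ε₁ := by
      have := mul_le_mul_of_nonneg_left hℓs (show 0 ≤ 2 * Real.sqrt N by positivity); linarith
    have h3 : 0 ≤ 1 + 2 * Real.sqrt N * w.selfLipLoad 0 x :=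
      add_nonneg zero_le_one (mul_nonneg (by positivity) (selfLipLoad_nonneg w 0 x))
    calc K * Real.exp (w.oscLoad 0 x) * (1 + 2 * Real.sqrt N * w.selfLipLoad 0 x) * (|β| / N)
        ≤ K * Real.exp ε₀ * (1 + 2 * Real.sqrt N * w.selfLipLoad 0 x) * (|β| / N) := by gcongr
      _ ≤ K * Real.exp ε₀ * (1 + 2 * Real.sqrt N * ε₁) * (|β| / N) := by gcongr
  have hP0 : 0 ≤ P := by
    have hd2 : (2 : ℝ) ≤ d := by exact_mod_cast hd
    exact le_max_of_le_left (mul_nonneg (mul_nonneg zero_le_two (by linarith)) (by positivity))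
  have hT0 : 0 ≤ T := by positivity
  -- split the row
  have hsplit : ∑ z ∈ nbr, (A * tInfluence x z + Real.sqrt N * w.crossLip 0 x z) *
        G (((2 * (z.1 i).val : ℕ) : ZMod (2 * L)) + (if z.2 = i then 1 else 0)) =
      A * ∑ z ∈ nbr, (tInfluence x z : ℝ) * G (((2 * (z.1 i).val : ℕ) : ZMod (2 * L)) + (if z.2 = i then 1 else 0)) +
        Real.sqrt N * ∑ z ∈ nbr, w.crossLip 0 x z * G (((2 * (z.1 i).val : ℕ) : ZMod (2 * L)) + (if z.2 = i then 1 else 0)) := by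
    rw [Finset.mul_sum, Finset.mul_sum, ← Finset.sum_add_distrib]
    exact Finset.sum_congr rfl fun z _ => by ring
  have hterm1 : ∑ z ∈ nbr, (tInfluence x z : ℝ) * G (((2 * (z.1 i).val : ℕ) : ZMod (2 * L)) + (if z.2 = i then 1 else 0)) ≤
      P * G (((2 * (x.1 i).val : ℕ) : ZMod (2 * L)) + (if x.2 = i then 1 else 0)) :=
    hW.trans (mul_le_mul_of_nonneg_right hPi hGx.le)
  have hterm2 : ∑ z ∈ nbr, w.crossLip 0 x z * G (((2 * (z.1 i).val : ℕ) : ZMod (2 * L)) + (if z.2 = i then 1 else 0)) ≤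
      w.crossLipLoad 0 x * (T * G (((2 * (x.1 i).val : ℕ) : ZMod (2 * L)) + (if x.2 = i then 1 else 0))) := by
    calc ∑ z ∈ nbr, w.crossLip 0 x z * G (((2 * (z.1 i).val : ℕ) : ZMod (2 * L)) + (if z.2 = i then 1 else 0))
        ≤ ∑ z ∈ nbr, w.crossLip 0 x z * (T * G (((2 * (x.1 i).val : ℕ) : ZMod (2 * L)) + (if x.2 = i then 1 else 0))) :=
          Finset.sum_le_sum fun z hz => mul_le_mul_of_nonneg_left (hcross z hz) (crossLip_nonneg w 0 x z)
      _ = (∑ z ∈ nbr, w.crossLip 0 x z) * (T * G (((2 * (x.1 i).val : ℕ) : ZMod (2 * L)) + (if x.2 = i then 1 else 0))) := by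
          rw [Finset.sum_mul]
      _ ≤ w.crossLipLoad 0 x * (T * G (((2 * (x.1 i).val : ℕ) : ZMod (2 * L)) + (if x.2 = i then 1 else 0))) := by
          refine mul_le_mul_of_nonneg_right ?_ (mul_nonneg hT0 hGx.le)
          exact Finset.sum_le_sum_of_subset_of_nonneg (Finset.filter_subset _ _) fun z _ _ => crossLip_nonneg w 0 x z
  have hcoef : A * P + Real.sqrt N * w.crossLipLoad 0 x * T ≤ s := by
    refine le_trans ?_ hsup
    have h1 : A * P ≤ K * Real.exp ε₀ * (1 + 2 * Real.sqrt N * ε₁) * (|β| / N) * P := mul_le_mul_of_nonneg_right hAle hP0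
    have h2 : Real.sqrt N * w.crossLipLoad 0 x * T ≤ Real.sqrt N * ε₁ * T :=
      mul_le_mul_of_nonneg_right (mul_le_mul_of_nonneg_left hΛ (Real.sqrt_nonneg _)) hT0
    exact add_le_add h1 h2
  change ∑ z ∈ nbr, (A * tInfluence x z + Real.sqrt N * w.crossLip 0 x z) *
      G (((2 * (z.1 i).val : ℕ) : ZMod (2 * L)) + (if z.2 = i then 1 else 0)) ≤
    s * G (((2 * (x.1 i).val : ℕ) : ZMod (2 * L)) + (if x.2 = i then 1 else 0))
  rw [hsplit]
  calc A * ∑ z ∈ nbr, (tInfluence x z : ℝ) * G (((2 * (z.1 i).val : ℕ) : ZMod (2 * L)) + (if z.2 = i then 1 else 0)) +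
        Real.sqrt N * ∑ z ∈ nbr, w.crossLip 0 x z * G (((2 * (z.1 i).val : ℕ) : ZMod (2 * L)) + (if z.2 = i then 1 else 0))
      ≤ A * (P * G (((2 * (x.1 i).val : ℕ) : ZMod (2 * L)) + (if x.2 = i then 1 else 0))) +
        Real.sqrt N * (w.crossLipLoad 0 x * (T * G (((2 * (x.1 i).val : ℕ) : ZMod (2 * L)) + (if x.2 = i then 1 else 0)))) :=
        add_le_add (mul_le_mul_of_nonneg_left hterm1 hA0) (mul_le_mul_of_nonneg_left hterm2 (Real.sqrt_nonneg _))
    _ = (A * P + Real.sqrt N * w.crossLipLoad 0 x * T) * G (((2 * (x.1 i).val : ℕ) : ZMod (2 * L)) + (if x.2 = i then 1 else 0)) := by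
        ring
    _ ≤ s * G (((2 * (x.1 i).val : ℕ) : ZMod (2 * L)) + (if x.2 = i then 1 else 0)) :=
        mul_le_mul_of_nonneg_right hcoef hGx.le

/-- **The plain row.**  Under the same condition the Dobrushin row at `x` over the range-`r ⊔ 1` neighbourhood is `≤ s` (`6(d−1) ≤ P(θ)`, `1 ≤ θ⁻¹^{…}`). [folklore] -/
theorem row_axis_le (hd : 2 ≤ d) (hL : 2 ≤ L) {β K ε₀ ε₁ θ s : ℝ} {r : ℕ} (hK : 0 ≤ K) (hθ0 : 0 < θ) (hθ1 : θ ≤ 1)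
    {W : Perturbation d L N} (w : LoadWitness W) (hwa : ∀ e, w.oscLoad 0 e ≤ ε₀)
    (hwℓ : ∀ e, w.selfLipLoad 0 e + w.crossLipLoad 0 e ≤ ε₁)
    (hsup : K * Real.exp ε₀ * (1 + 2 * Real.sqrt N * ε₁) * (|β| / N) *
        max (2 * ((d : ℝ) - 1) * (θ + θ⁻¹ + 1)) (θ⁻¹ ^ 2 + 2 * θ⁻¹ + 2 * θ + θ ^ 2 + 6 * ((d : ℝ) - 2)) +
      Real.sqrt N * ε₁ * θ⁻¹ ^ (2 * max r 1 + 1) ≤ s) (x : Edge d L) :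
    ∑ z ∈ (univ.erase x).filter (fun y => torusNorm (x.1 - y.1) ≤ max r 1),
        (K * Real.exp (w.oscLoad 0 x) * (1 + 2 * Real.sqrt N * w.selfLipLoad 0 x) * (|β| / N) * tInfluence x z +
          Real.sqrt N * w.crossLip 0 x z) ≤ s := by
  have hL1 : 1 < L := by omega
  have hd1 : 1 ≤ d := by omega
  refine le_trans (Finset.sum_le_sum_of_subset_of_nonneg (Finset.filter_subset _ _) fun z _ _ => robustEntry_nonneg hK β w x z) ?_
  refine (sum_erase_robustEntry_le hd1 hL1 hK β w x).trans (le_trans ?_ hsup)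
  have hℓs : w.selfLipLoad 0 x ≤ ε₁ := by linarith [hwℓ x, crossLipLoad_nonneg w 0 x]
  have hΛ : w.crossLipLoad 0 x ≤ ε₁ := by linarith [hwℓ x, selfLipLoad_nonneg w 0 x]
  have hd2 : (2 : ℝ) ≤ d := by exact_mod_cast hd
  have hθθ : 2 ≤ θ + θ⁻¹ := by
    have e : θ + θ⁻¹ - 2 = (θ - 1) ^ 2 / θ := by field_simp; ring
    have : 0 ≤ (θ - 1) ^ 2 / θ := div_nonneg (sq_nonneg _) hθ0.le
    linarith
  have hP : 6 * ((d : ℝ) - 1) ≤ max (2 * ((d : ℝ) - 1) * (θ + θ⁻¹ + 1)) (θ⁻¹ ^ 2 + 2 * θ⁻¹ + 2 * θ + θ ^ 2 + 6 * ((d : ℝ) - 2)) :=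
    le_max_of_le_left (by nlinarith)
  have hT : (1 : ℝ) ≤ θ⁻¹ ^ (2 * max r 1 + 1) := one_le_pow₀ ((one_le_inv₀ hθ0).2 hθ1)
  have hA0 : 0 ≤ K * Real.exp (w.oscLoad 0 x) * (1 + 2 * Real.sqrt N * w.selfLipLoad 0 x) * (|β| / N) :=
    mul_nonneg (mul_nonneg (mul_nonneg hK (Real.exp_pos _).le)
      (add_nonneg zero_le_one (mul_nonneg (by positivity) (selfLipLoad_nonneg w 0 x)))) (by positivity)
  have hAle : K * Real.exp (w.oscLoad 0 x) * (1 + 2 * Real.sqrt N * w.selfLipLoad 0 x) * (|β| / N) ≤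
      K * Real.exp ε₀ * (1 + 2 * Real.sqrt N * ε₁) * (|β| / N) := by
    have h1 : Real.exp (w.oscLoad 0 x) ≤ Real.exp ε₀ := Real.exp_le_exp.2 (hwa x)
    have h2 : 1 + 2 * Real.sqrt N * w.selfLipLoad 0 x ≤ 1 + 2 * Real.sqrt N * ε₁ := by
      have := mul_le_mul_of_nonneg_left hℓs (show 0 ≤ 2 * Real.sqrt N by positivity); linarith
    have h3 : 0 ≤ 1 + 2 * Real.sqrt N * w.selfLipLoad 0 x :=
      add_nonneg zero_le_one (mul_nonneg (by positivity) (selfLipLoad_nonneg w 0 x))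
    calc K * Real.exp (w.oscLoad 0 x) * (1 + 2 * Real.sqrt N * w.selfLipLoad 0 x) * (|β| / N)
        ≤ K * Real.exp ε₀ * (1 + 2 * Real.sqrt N * w.selfLipLoad 0 x) * (|β| / N) := by gcongr
      _ ≤ K * Real.exp ε₀ * (1 + 2 * Real.sqrt N * ε₁) * (|β| / N) := by gcongr
  have hA1 : 0 ≤ K * Real.exp ε₀ * (1 + 2 * Real.sqrt N * ε₁) * (|β| / N) := hA0.trans hAle
  have hd6 : 0 ≤ 6 * ((d : ℝ) - 1) := by linarith
  calc K * Real.exp (w.oscLoad 0 x) * (1 + 2 * Real.sqrt N * w.selfLipLoad 0 x) * (|β| / N) * (6 * ((d : ℝ) - 1)) +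
        Real.sqrt N * w.crossLipLoad 0 x
      ≤ K * Real.exp ε₀ * (1 + 2 * Real.sqrt N * ε₁) * (|β| / N) * (6 * ((d : ℝ) - 1)) + Real.sqrt N * ε₁ * 1 := by
        rw [mul_one]
        exact add_le_add (mul_le_mul_of_nonneg_right hAle hd6) (mul_le_mul_of_nonneg_left hΛ (Real.sqrt_nonneg _))
    _ ≤ _ := add_le_add (mul_le_mul_of_nonneg_left hP hA1)
        (mul_le_mul_of_nonneg_left hT (mul_nonneg (Real.sqrt_nonneg _) ((selfLipLoad_nonneg w 0 x).trans hℓs)))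

end Column

end Summit.Ventures.YMGap.RobustBall.TorusAxis

end
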